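import Summits.NavierStokesRegularity.NavierStokesRegularity.Theorems.CertifiedBlowupCertifiedBlowupVorticityRateBlowupConstantFloorSharp
import HarnessLib

/-!
# Certificate class `CertifiedBlowupVorticityRateBlowup` (stmt-NavierStokesRegularity-8639): THE FLOOR CHAIN RUN WITH
# THE SOLUTION'S OWN INTEGRATED STRETCHING COEFFICIENT — `(D_κ) ⇒ (S_κ)`, `C_ω ≥ 1/(2κ)`, AND THE SLAB-MEAN FORM

Theorems file landed `--supports stmt-NavierStokesRegularity-8639` (cell `ns-blowup`, GROUP B zone Z1 → the certificate
crux; thirteenth crux-side deposit of the zone-Z1 seat, lead letter (ns)). Deposits 9–11 (`…SlabFloor`,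
`…SlabExponent`, `…ConstantFloorSharp`) run the floor chain PARAMETRICALLY in the coefficient `κ` of the slab Grönwall

  `(S_κ)`: for all `0 ≤ t₁ < t₂ < T` and `Ω` with `‖curl u(t, x)‖ ≤ Ω` on `[t₁, t₂] × ℝ³`,
  `∫|curl u(t₂)|² ≤ (∫|curl u(t₁)|²) · exp(κ Ω (t₂ − t₁))`,

and supply `(S_κ)` KINEMATICALLY — for every field — with `κ = 2` (RRS 2016 (12.11)) and `κ = 2/√3` (Chae's strain
bound), whence `C_ω > √3/4`. The only input of `(S_κ)` is a bound on the INTEGRATED vortex stretching. This file takes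
that bound itself as the hypothesis — the solution's own STRETCHING (DEPLETION) COEFFICIENT, a bound variable of every
statement (no definition is introduced; nothing asserts that any field beats the kinematic value):

  `(D_κ)` at time `t`: for every `Ω` with `‖curl u(t, x)‖ ≤ Ω` for all `x`,
  `2∫⟪curl u(t), (∇u(t)) curl u(t)⟫ ≤ κ · Ω · ∫|curl u(t)|²`.

* `integral_sq_norm_curl_le_mul_exp_of_stretching_le`, `slab_gronwall_of_stretching_le` — THE SLAB GRÖNWALL UNDER A
  PRODUCTION-RATE BOUND `2∫⟪ω, (∇u)ω⟫ ≤ a∫|ω|²` (`a ≥ 0`): `∫|ω(t₂)|² ≤ ∫|ω(t₁)|²·exp(a(t₂ − t₁))` (the tree's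
  `integral_sq_norm_curl_le_of_direction_slab` with `C₁ = a`, `C₂ = C₃ = C₄ = 0`, energy inputs from Tao's class);
* `slab_of_depletion` — **`(D_κ)` on `[0, T)` ⇒ `(S_κ)`** (`κ ≥ 0`), in the exact binder form `hslab` of deposits 9–10;
* `depletion_le_two`, `depletion_le_sharp` — NON-VACUITY / KINEMATIC RANGE: `(D_2)` and `(D_{2/√3})` hold at every time
  of every classical solution in the class (the Literature slice lemmas of RRS (12.11) / Chae); `slab_gronwall_two` and
  `slab_gronwall_sharp` are recovered by `example`;
* `inv_two_mul_le_of_stretching_le` — **THE FLOOR `1/(2κ) ≤ C_ω` UNDER `(D_κ)`** (deposit 9's `inv_two_mul_le_of_slab` BY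
  NAME); `vorticityRate_witness_velocity_exponent_of_depletion` — for the witnesses: `1/(2κ) < C_ω` strictly and
  `(T − t)^{1+κC}‖u‖³ ≤ K` (deposit 10's dictionary BY NAME);
* `integral_sq_norm_curl_geometric_of_depletion` — PER-SLAB COEFFICIENTS `κₙ ≥ 0` on the geometric slabs
  `tₙ = T − (T − t₀)q⁻ⁿ` (only times `≥ t₀` enter): `∫|ω(t_N)|² ≤ ∫|ω(t₀)|²·exp(C(q − 1)·Σ_{n<N} κₙ)`;
* `exists_log_le_sum_depletion` — **THE SLAB-MEAN FORM**: against Leray's rate (`leray_le_integral_sq_norm_curl` BY NAME)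
  there is `K` (explicitly `K = log(∫|ω(t₀)|²·√(T − t₀)/(cν^{3/2}))`) with
  **`(N/2)·log q − K ≤ C(q − 1)·Σ_{n<N} κₙ` for every `q > 1`, every admissible `(κₙ)`, every `N`** — the Cesàro means
  of `κₙ` have `liminf ≥ log q/(2C(q − 1))`, i.e. `C_ω · κ̄ ≥ ½` as `q → 1⁺`.

READING (K-audit hook): with `κ` the candidate's OWN normalised production `2∫ω·Sω dx/(‖ω(t)‖_∞∫|ω(t)|²) ∈ [−2/√3, 2/√3]`
(a quantity every profile instrument can print), the floor of the certificate constant is `1/(2κ̄)`; the kinematic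
`κ̄ = 2/√3` recovers `√3/4` and moves nothing. No new definitions, no named-fact hypotheses, no `sorry`. WHAT THIS IS
NOT: not a blow-up or regularity claim — a priori inequalities about a HYPOTHETICAL witness of the certificate class under
hypotheses on its own stretching integral; crux 8639, crux 8640, the floor `√3/4` and (AX-L) are untouched. Author:
ns-blowup-profile-eng-1 g14, 2026-08-27.

## References
* J. C. Robinson, J. L. Rodrigo, W. Sadowski, *The Three-Dimensional Navier–Stokes Equations*, CUP 2016, Thm 12.3
  (12.11)–(12.12). [RobinsonRodrigoSadowski2016]
* D. Chae, Comm. Math. Phys. 263 (2005), Thm 2.2. [Chae2005]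
* J. Leray, Acta Math. 63 (1934), §20 (3.12). [Leray1934]
* P. Constantin, SIAM Rev. 36 (1994) 73–98, §3 (depletion of nonlinearity). [Constantin1994]
-/

-- the summit and its single problem share the name (D-0017 nested layout)
set_option linter.dupNamespace false

noncomputable section

open MeasureTheory Set Function Filter Topology Metric
open scoped ENNReal NNReal RealInnerProductSpace ContDiff

namespace Summit.NavierStokesRegularity.NavierStokesRegularity.Theorems.CertifiedBlowupVorticityRateBlowup.DepletionFloor

open Literature.Analysis.FluidPDE
open Summit.NavierStokesRegularity.NavierStokesRegularity.Theorems.CertifiedBlowupAxisymBlowup.CompactAmplification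
open Summit.NavierStokesRegularity.NavierStokesRegularity.Theorems.CertifiedBlowupVorticityRateBlowup.ConstantFloor
open Summit.NavierStokesRegularity.NavierStokesRegularity.Theorems.CertifiedBlowupVorticityRateBlowup.SlabFloor

variable {ν T : ℝ} {u : ℝ → EuclideanSpace ℝ (Fin 3) → EuclideanSpace ℝ (Fin 3)}
  {p : ℝ → EuclideanSpace ℝ (Fin 3) → ℝ}

/-! ### The slab Grönwall under a bound on the integrated stretching -/

/-- **Enstrophy slab Grönwall under a production-rate bound.** A classical unforced solution on `[0, T''] × ℝ³`, `ν > 0`,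
in the Beale–Kato–Majda class, whose integrated stretching obeys `2∫⟪curl u(t), (∇u(t)) curl u(t)⟫ ≤ a·∫|curl u(t)|²`
for `t ∈ [0, T'']` (`a ≥ 0`), has `∫|curl u(t)|² ≤ (∫|curl u(0)|²)·exp(a T'')` on `[0, T'']` — the tree's slab Grönwall
`integral_sq_norm_curl_le_of_direction_slab` with `C₁ = a`, `C₂ = C₃ = C₄ = 0`, energy and dissipation inputs from
`tao_finite_energy_smooth_energy_bound_holds`; RRS (12.12) with the pointwise step (12.11) replaced by the hypothesis.
[cite: RobinsonRodrigoSadowski2016, Thm 12.3 (12.12)] -/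
theorem integral_sq_norm_curl_le_mul_exp_of_stretching_le {ν T'' : ℝ} (hν : 0 < ν) (hT'' : 0 < T'')
    {u : ℝ → EuclideanSpace ℝ (Fin 3) → EuclideanSpace ℝ (Fin 3)} {p : ℝ → EuclideanSpace ℝ (Fin 3) → ℝ}
    (hS : IsClassicalNSSolutionOn (Icc 0 T'') ν 0 u p) (hB : HasBoundedSobolevNormsOn (Icc 0 T'') u)
    {a : ℝ} (ha : 0 ≤ a)
    (hstr : ∀ t ∈ Icc 0 T'', 2 * ∫ x, ⟪curl (u t) x, fderiv ℝ (u t) x (curl (u t) x)⟫ ≤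
      a * ∫ x, ‖curl (u t) x‖ ^ 2) :
    ∀ t ∈ Icc 0 T'', ∫ x, ‖curl (u t) x‖ ^ 2 ≤ (∫ x, ‖curl (u 0) x‖ ^ 2) * Real.exp (a * T'') := by
  obtain ⟨C, hCtop, hTao⟩ := tao_finite_energy_smooth_energy_bound_holds
  have h0S : (0 : ℝ) ∈ Icc 0 T'' := ⟨le_rfl, hT''.le⟩
  set E₀ : ℝ≥0∞ := ∫⁻ x, ‖u 0 x‖ₑ ^ 2 with hE₀
  have hfe : ∃ A : ℝ≥0∞, A < ⊤ ∧ ∀ s ∈ Icc 0 T'', ∫⁻ x, ‖u s x‖ₑ ^ 2 ≤ A := by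
    obtain ⟨C0, hC0⟩ := hB 0
    refine ⟨C0, ENNReal.coe_lt_top, fun s hs => ?_⟩
    refine le_trans (le_of_eq (lintegral_congr fun x => ?_)) (hC0 s hs)
    rw [← ofReal_norm, ← ofReal_norm, norm_iteratedFDeriv_zero]
  have hE₀top : E₀ < ⊤ := by
    obtain ⟨A, hAtop, hA⟩ := hfe
    exact (hA 0 h0S).trans_lt hAtop
  have hCE : C * E₀ < ⊤ := ENNReal.mul_lt_top hCtop hE₀top
  obtain ⟨hen, hdiss⟩ := hTao ν T'' hν hT'' u p hS hfe
  set Ē : ℝ := (C * E₀).toReal with hĒ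
  have hĒ0 : 0 ≤ Ē := ENNReal.toReal_nonneg
  set I : ℝ := (C * E₀ / ENNReal.ofReal ν).toReal with hIdef
  have hI0 : 0 ≤ I := ENNReal.toReal_nonneg
  have hen' : ∀ s ∈ Icc 0 T'', ∫⁻ x, ‖u s x‖ₑ ^ 2 ≤ ENNReal.ofReal Ē := fun s hs => by
    rw [hĒ, ENNReal.ofReal_toReal hCE.ne]
    exact hen s hs
  have hdiss' : ∫⁻ s in Ioo 0 T'', ∫⁻ x, ENNReal.ofReal (frobeniusNormSq (fderiv ℝ (u s) x)) ≤
      ENNReal.ofReal I := by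
    have hν' : ENNReal.ofReal ν ≠ 0 := (ENNReal.ofReal_pos.2 hν).ne'
    have h1 : ∫⁻ s in Ioo 0 T'', ∫⁻ x, ENNReal.ofReal (frobeniusNormSq (fderiv ℝ (u s) x)) ≤
        C * E₀ / ENNReal.ofReal ν := by
      rw [ENNReal.le_div_iff_mul_le (Or.inl hν') (Or.inl ENNReal.ofReal_ne_top), mul_comm]
      exact hdiss
    refine h1.trans (le_of_eq ?_)
    rw [hIdef, ENNReal.ofReal_toReal]
    exact (ENNReal.div_lt_top hCE.ne hν').ne
  -- the hypothesis, in the shape of the slab Grönwall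
  have hstrS : ∀ s ∈ Icc 0 T'',
      2 * ∫ x, ⟪curl (u s) x, fderiv ℝ (u s) x (curl (u s) x)⟫ ≤
        ν * (∫ x, frobeniusNormSq (fderiv ℝ (curl (u s)) x)) +
          (a + 0 * (∫ x, ‖curl (u s) x‖ ^ 2) + 0 * (∫ x, ‖u s x‖ ^ 2)) *
            (∫ x, ‖curl (u s) x‖ ^ 2) +
          0 * (∫ x, frobeniusNormSq (fderiv ℝ (u s) x)) := by
    intro s hs
    have hdissip : 0 ≤ ν * (∫ x, frobeniusNormSq (fderiv ℝ (curl (u s)) x)) :=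
      mul_nonneg hν.le (integral_nonneg fun x => frobeniusNormSq_nonneg _)
    have hmain := hstr s hs
    have hrw : ν * (∫ x, frobeniusNormSq (fderiv ℝ (curl (u s)) x)) +
          (a + 0 * (∫ x, ‖curl (u s) x‖ ^ 2) + 0 * (∫ x, ‖u s x‖ ^ 2)) *
            (∫ x, ‖curl (u s) x‖ ^ 2) + 0 * (∫ x, frobeniusNormSq (fderiv ℝ (u s) x)) =
        ν * (∫ x, frobeniusNormSq (fderiv ℝ (curl (u s)) x)) + a * ∫ x, ‖curl (u s) x‖ ^ 2 := by
      ring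
    rw [hrw]
    linarith
  intro t ht
  have hY := integral_sq_norm_curl_le_of_direction_slab hν hT'' hS hB hĒ0 hI0 hen' hdiss'
    ha le_rfl le_rfl le_rfl hstrS t ht
  have hrw : ((∫ x, ‖curl (u 0) x‖ ^ 2) + 0 * I) *
        Real.exp ((a + 0 * Ē) * T'' + 0 * (‖curlCLM‖ ^ 2 * I)) =
      (∫ x, ‖curl (u 0) x‖ ^ 2) * Real.exp (a * T'') := by
    congr 1
    · ring
    · congr 1; ring
  rw [hrw] at hY
  exact hY

/-- **The same on any slab `[t₁, t₂] ⊂ [0, T)`.** For a classical unforced solution on `[0, T) × ℝ³`, `ν > 0`, in the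
Beale–Kato–Majda class on every `[0, T'']`, `T'' < T`: if `2∫⟪ω, (∇u)ω⟫(t) ≤ a∫|ω(t)|²` for `t ∈ [t₁, t₂]` (`a ≥ 0`),
then `∫|ω(t₂)|² ≤ ∫|ω(t₁)|²·exp(a(t₂ − t₁))` (the previous theorem for the translate `u(· + t₁)`).
[cite: RobinsonRodrigoSadowski2016, Thm 12.3 (12.12)] -/
theorem slab_gronwall_of_stretching_le (hν : 0 < ν) (hcl : IsClassicalNSSolutionOn (Ico 0 T) ν 0 u p)
    (hreg : ∀ T'' < T, HasBoundedSobolevNormsOn (Icc 0 T'') u)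
    ⦃t₁ t₂ a : ℝ⦄ (ht₁ : 0 ≤ t₁) (h12 : t₁ < t₂) (ht₂ : t₂ < T) (ha : 0 ≤ a)
    (hstr : ∀ t ∈ Icc t₁ t₂, 2 * ∫ x, ⟪curl (u t) x, fderiv ℝ (u t) x (curl (u t) x)⟫ ≤
      a * ∫ x, ‖curl (u t) x‖ ^ 2) :
    ∫ x, ‖curl (u t₂) x‖ ^ 2 ≤ (∫ x, ‖curl (u t₁) x‖ ^ 2) * Real.exp (a * (t₂ - t₁)) := by
  set v : ℝ → EuclideanSpace ℝ (Fin 3) → EuclideanSpace ℝ (Fin 3) := fun s => u (s + t₁) with hv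
  have hd : 0 < t₂ - t₁ := sub_pos.2 h12
  have hS : IsClassicalNSSolutionOn (Icc 0 (t₂ - t₁)) ν 0 v (fun s => p (s + t₁)) :=
    (hcl.translate_Ico_zero ht₁).mono (Icc_subset_Ico_right (by linarith)) (uniqueDiffOn_Icc hd)
  have hB : HasBoundedSobolevNormsOn (Icc 0 (t₂ - t₁)) v := fun n => by
    obtain ⟨Cn, hCn⟩ := hreg t₂ ht₂ n
    exact ⟨Cn, fun s hs => hCn (s + t₁) ⟨by linarith [hs.1], by linarith [hs.2]⟩⟩
  have hstr' : ∀ s ∈ Icc 0 (t₂ - t₁), 2 * ∫ x, ⟪curl (v s) x, fderiv ℝ (v s) x (curl (v s) x)⟫ ≤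
      a * ∫ x, ‖curl (v s) x‖ ^ 2 := fun s hs =>
    hstr (s + t₁) ⟨by linarith [hs.1], by linarith [hs.2]⟩
  have h := integral_sq_norm_curl_le_mul_exp_of_stretching_le hν hd hS hB ha hstr' (t₂ - t₁) ⟨hd.le, le_rfl⟩
  simpa only [hv, sub_add_cancel, zero_add] using h

/-! ### `(D_κ) ⇒ (S_κ)` -/

/-- **`(D_κ)` on `[0, T)` implies the slab Grönwall `(S_κ)`** (`κ ≥ 0`): if at every `t ∈ [0, T)`, for every `Ω` with
`‖curl u(t, x)‖ ≤ Ω` for all `x`, `2∫⟪ω, (∇u)ω⟫(t) ≤ κΩ∫|ω(t)|²`, then for all `0 ≤ t₁ < t₂ < T` and `Ω` with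
`‖curl u‖ ≤ Ω` on `[t₁, t₂] × ℝ³`: `∫|ω(t₂)|² ≤ ∫|ω(t₁)|²·exp(κΩ(t₂ − t₁))` — the binder `hslab` of deposits 9–10.
[new here — elementary] -/
theorem slab_of_depletion (hν : 0 < ν) (hcl : IsClassicalNSSolutionOn (Ico 0 T) ν 0 u p)
    (hreg : ∀ T'' < T, HasBoundedSobolevNormsOn (Icc 0 T'') u) {κ : ℝ} (hκ : 0 ≤ κ)
    (hdep : ∀ t ∈ Ico 0 T, ∀ Ω : ℝ, (∀ x, ‖curl (u t) x‖ ≤ Ω) →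
      2 * ∫ x, ⟪curl (u t) x, fderiv ℝ (u t) x (curl (u t) x)⟫ ≤ κ * Ω * ∫ x, ‖curl (u t) x‖ ^ 2) :
    ∀ ⦃t₁ t₂ Ω : ℝ⦄, 0 ≤ t₁ → t₁ < t₂ → t₂ < T → (∀ t ∈ Icc t₁ t₂, ∀ x, ‖curl (u t) x‖ ≤ Ω) →
      ∫ x, ‖curl (u t₂) x‖ ^ 2 ≤ (∫ x, ‖curl (u t₁) x‖ ^ 2) * Real.exp (κ * Ω * (t₂ - t₁)) := by
  intro t₁ t₂ Ω ht₁ h12 ht₂ hω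
  have hΩ0 : 0 ≤ Ω := (norm_nonneg _).trans (hω t₁ ⟨le_rfl, h12.le⟩ 0)
  exact slab_gronwall_of_stretching_le hν hcl hreg ht₁ h12 ht₂ (mul_nonneg hκ hΩ0) fun t ht =>
    hdep t ⟨ht₁.trans ht.1, lt_of_le_of_lt ht.2 ht₂⟩ Ω (hω t ht)

/-! ### Non-vacuity: the kinematic coefficients `2` and `2/√3` -/

/-- Slice inputs of the Literature stretching lemmas (`C²`, `u(t) ∈ L²`, `∇u(t) ∈ L²`) read off the Beale–Kato–Majda
class on `[0, (t + T)/2]`. [folklore] -/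
private theorem slice_inputs (hcl : IsClassicalNSSolutionOn (Ico 0 T) ν 0 u p)
    (hreg : ∀ T'' < T, HasBoundedSobolevNormsOn (Icc 0 T'') u) {t : ℝ} (ht : t ∈ Ico 0 T) :
    ContDiff ℝ 2 (u t) ∧ ∫⁻ x, ‖u t x‖ₑ ^ 2 < ⊤ ∧ Integrable fun x => ‖fderiv ℝ (u t) x‖ ^ 2 := by
  have hB : HasBoundedSobolevNormsOn (Icc 0 ((t + T) / 2)) u := hreg _ (by linarith [ht.2])
  have htS : t ∈ Icc 0 ((t + T) / 2) := ⟨ht.1, by linarith [ht.2]⟩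
  have hv : ContDiff ℝ ∞ (u t) := hcl.contDiff_velocity ht
  have hv4 : ContDiff ℝ 4 (u t) := hv.of_le (by norm_cast)
  have hfin : ∀ n, ∫⁻ x, ‖iteratedFDeriv ℝ n (u t) x‖ₑ ^ 2 < ⊤ := fun n => by
    obtain ⟨Cn, hCn⟩ := hB n
    exact (hCn t htS).trans_lt ENNReal.coe_lt_top
  refine ⟨hv.of_le (by norm_cast), ?_, ?_⟩
  · refine lt_of_le_of_lt (le_of_eq (lintegral_congr fun x => ?_)) (hfin 0)
    rw [← ofReal_norm, ← ofReal_norm, norm_iteratedFDeriv_zero]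
  · have h := integrable_sq_norm_of_lintegral_lt_top (hv4.continuous_iteratedFDeriv (by norm_num)) (hfin 1)
    exact h.congr (Eventually.of_forall fun x => by simp only [norm_iteratedFDeriv_one])

/-- **`(D_2)` holds at every time of every classical solution in the class** (RRS (12.11): `2∫⟪ω, (∇u)ω⟫ ≤ 2Ω∫|ω|²`,
the Literature slice lemma `two_mul_integral_stretching_le_of_norm_curl_le`).
[cite: RobinsonRodrigoSadowski2016, Thm 12.3 (12.11)] -/
theorem depletion_le_two (hcl : IsClassicalNSSolutionOn (Ico 0 T) ν 0 u p)
    (hreg : ∀ T'' < T, HasBoundedSobolevNormsOn (Icc 0 T'') u) :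
    ∀ t ∈ Ico 0 T, ∀ Ω : ℝ, (∀ x, ‖curl (u t) x‖ ≤ Ω) →
      2 * ∫ x, ⟪curl (u t) x, fderiv ℝ (u t) x (curl (u t) x)⟫ ≤ 2 * Ω * ∫ x, ‖curl (u t) x‖ ^ 2 :=
  fun t ht _ hΩ =>
    have h := slice_inputs hcl hreg ht
    two_mul_integral_stretching_le_of_norm_curl_le h.1 (hcl.divFree t ht) h.2.1 h.2.2 hΩ

/-- **`(D_{2/√3})` holds at every time of every classical solution in the class** — the KINEMATIC RANGE of the
coefficient (Chae's `λ_max(S)² ≤ ⅔|S|²`, `tr S = 0`, `∫|∇u|²_F ≤ ∫|ω|²`; the Literature slice lemma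
`two_mul_integral_stretching_le_sharp_of_norm_curl_le`). [cite: Chae2005, Thm 2.2] -/
theorem depletion_le_sharp (hcl : IsClassicalNSSolutionOn (Ico 0 T) ν 0 u p)
    (hreg : ∀ T'' < T, HasBoundedSobolevNormsOn (Icc 0 T'') u) :
    ∀ t ∈ Ico 0 T, ∀ Ω : ℝ, (∀ x, ‖curl (u t) x‖ ≤ Ω) →
      2 * ∫ x, ⟪curl (u t) x, fderiv ℝ (u t) x (curl (u t) x)⟫ ≤
        2 / Real.sqrt 3 * Ω * ∫ x, ‖curl (u t) x‖ ^ 2 :=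
  fun t ht _ hΩ =>
    have h := slice_inputs hcl hreg ht
    two_mul_integral_stretching_le_sharp_of_norm_curl_le h.1 (hcl.divFree t ht) h.2.1 h.2.2 hΩ

/-- `slab_of_depletion` with the kinematic coefficient `2` (`depletion_le_two`) closes deposit 9's `slab_gronwall_two`
statement verbatim. [cite: RobinsonRodrigoSadowski2016, Thm 12.3 (12.11)–(12.12)] -/
example (hν : 0 < ν) (hcl : IsClassicalNSSolutionOn (Ico 0 T) ν 0 u p)
    (hreg : ∀ T'' < T, HasBoundedSobolevNormsOn (Icc 0 T'') u) :
    ∀ ⦃t₁ t₂ Ω : ℝ⦄, 0 ≤ t₁ → t₁ < t₂ → t₂ < T → (∀ t ∈ Icc t₁ t₂, ∀ x, ‖curl (u t) x‖ ≤ Ω) →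
      ∫ x, ‖curl (u t₂) x‖ ^ 2 ≤ (∫ x, ‖curl (u t₁) x‖ ^ 2) * Real.exp (2 * Ω * (t₂ - t₁)) :=
  slab_of_depletion hν hcl hreg zero_le_two (depletion_le_two hcl hreg)

/-- … and with `2/√3` (`depletion_le_sharp`) closes deposit 11's `slab_gronwall_sharp` statement verbatim.
[cite: Chae2005, Thm 2.2; RobinsonRodrigoSadowski2016, Thm 12.3 (12.12)] -/
example (hν : 0 < ν) (hcl : IsClassicalNSSolutionOn (Ico 0 T) ν 0 u p)
    (hreg : ∀ T'' < T, HasBoundedSobolevNormsOn (Icc 0 T'') u) :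
    ∀ ⦃t₁ t₂ Ω : ℝ⦄, 0 ≤ t₁ → t₁ < t₂ → t₂ < T → (∀ t ∈ Icc t₁ t₂, ∀ x, ‖curl (u t) x‖ ≤ Ω) →
      ∫ x, ‖curl (u t₂) x‖ ^ 2 ≤ (∫ x, ‖curl (u t₁) x‖ ^ 2) * Real.exp (2 / Real.sqrt 3 * Ω * (t₂ - t₁)) :=
  slab_of_depletion hν hcl hreg two_div_sqrt_three_pos.le (depletion_le_sharp hcl hreg)

/-! ### The floor `1/(2κ)` under `(D_κ)`, for the witnesses of the certificate class -/

/-- **THE FLOOR UNDER `(D_κ)`: `1/(2κ) ≤ C`.** For a maximal Leray–Hopf classical solution of finite lifespan `T > 0` from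
a rapidly decaying axisymmetric datum, `ν > 0`, obeying `(D_κ)` on `[0, T)` with `κ > 0`, and the rate
`(T − t)‖curl u(t, x)‖ ≤ C` on `[t₀, T) × ℝ³`: `1/(2κ) ≤ C` — deposit 9's `inv_two_mul_le_of_slab` with `(S_κ)` supplied
by `slab_of_depletion`. [cite: RobinsonRodrigoSadowski2016, Thm 12.3 (12.11)–(12.12); Leray1934, §20 (3.12)] -/
theorem inv_two_mul_le_of_stretching_le (hν : 0 < ν) (hT : 0 < T) (hmax : IsMaximalSmoothSolution ν 0 u p T)
    (hLH : IsLerayHopfOn T ν 0 (u 0) u) (hdec : HasRapidSpatialDecay (u 0)) (haxi : IsAxisymmetric (u 0))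
    {κ : ℝ} (hκ : 0 < κ)
    (hdep : ∀ t ∈ Ico 0 T, ∀ Ω : ℝ, (∀ x, ‖curl (u t) x‖ ≤ Ω) →
      2 * ∫ x, ⟪curl (u t) x, fderiv ℝ (u t) x (curl (u t) x)⟫ ≤ κ * Ω * ∫ x, ‖curl (u t) x‖ ^ 2)
    {C t₀ : ℝ} (ht₀ : 0 ≤ t₀) (ht₀T : t₀ < T) (hω : ∀ t ∈ Ico t₀ T, ∀ x, (T - t) * ‖curl (u t) x‖ ≤ C) :
    1 / (2 * κ) ≤ C :=
  inv_two_mul_le_of_slab hν hT hmax hLH hdec haxi hκ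
    (slab_of_depletion hν hmax.1 (hasBoundedSobolevNormsOn_before_of_lerayHopf_classical hν hT hmax.1 hLH hdec)
      hκ.le hdep) ht₀ ht₀T hω

/-- **CERTIFICATE-CLASS WITNESSES OBEYING `(D_κ)`: `1/(2κ) < C` STRICTLY, AND VELOCITY RATE EXPONENT `≤ (1 + κC)/3`.**
For every `(ν, T, u, p)` of the certificate class `CertifiedBlowupVorticityRateBlowup` whose integrated stretching obeys
`(D_κ)` on `[0, T)`, `κ > 0`, and every `C` with `(T − t)‖curl u(t, x)‖ ≤ C` for all `x` and all `t` near `T⁻`: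
`1/(2κ) < C`, and `(T − t)^{1 + κC}‖u(t, x)‖³ ≤ K` on some `[t₀, T) × ℝ³` — deposit 10's
`vorticityRate_witness_velocity_exponent_of_slab` BY NAME, `(S_κ)` from `slab_of_depletion`.
[cite: RobinsonRodrigoSadowski2016, Thm 12.3 (12.11)–(12.12); Leray1934, §20 (3.12)] -/
theorem vorticityRate_witness_velocity_exponent_of_depletion (hν : 0 < ν) (hT : 0 < T)
    (hmax : IsMaximalSmoothSolution ν 0 u p T) (hLH : IsLerayHopfOn T ν 0 (u 0) u)
    (hdec : HasRapidSpatialDecay (u 0)) (haxi : IsAxisymmetric (u 0)) {κ : ℝ} (hκ : 0 < κ)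
    (hdep : ∀ t ∈ Ico 0 T, ∀ Ω : ℝ, (∀ x, ‖curl (u t) x‖ ≤ Ω) →
      2 * ∫ x, ⟪curl (u t) x, fderiv ℝ (u t) x (curl (u t) x)⟫ ≤ κ * Ω * ∫ x, ‖curl (u t) x‖ ^ 2)
    {C : ℝ} (hrate : ∀ᶠ t in 𝓝[<] T, ∀ x : EuclideanSpace ℝ (Fin 3), (T - t) * ‖curl (u t) x‖ ≤ C) :
    1 / (2 * κ) < C ∧ ∃ t₀ ∈ Ico 0 T, ∃ K : ℝ, 0 ≤ K ∧
      ∀ t ∈ Ico t₀ T, ∀ x : EuclideanSpace ℝ (Fin 3), (T - t) ^ (1 + κ * C) * ‖u t x‖ ^ 3 ≤ K :=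
  vorticityRate_witness_velocity_exponent_of_slab hν hT hmax hLH hdec haxi hκ
    (slab_of_depletion hν hmax.1 (hasBoundedSobolevNormsOn_before_of_lerayHopf_classical hν hT hmax.1 hLH hdec)
      hκ.le hdep) hrate

/-! ### Per-slab coefficients on geometric slabs: the slab-mean form -/

/-- **Geometric slabs with their own coefficients.** For a classical unforced solution on `[0, T) × ℝ³` (BKM class on
closed sub-slabs) with `(T − t)‖curl u(t, x)‖ ≤ C` on `[t₀, T) × ℝ³`, `q > 1`, `tₙ := T − (T − t₀)q⁻ⁿ`: if on each slab
`[tₙ, tₙ₊₁]` the integrated stretching obeys `(D_{κₙ})` (`κₙ ≥ 0`), then for every `N`,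
`∫|ω(t_N)|² ≤ (∫|ω(t₀)|²)·exp(C(q − 1)·Σ_{n<N} κₙ)` — on slab `n` the vorticity is at most `C/(T − tₙ₊₁)` and
`κₙ·(C/(T − tₙ₊₁))·(tₙ₊₁ − tₙ) = C(q − 1)κₙ`. [new here — elementary] -/
theorem integral_sq_norm_curl_geometric_of_depletion (hν : 0 < ν)
    (hcl : IsClassicalNSSolutionOn (Ico 0 T) ν 0 u p) (hreg : ∀ T'' < T, HasBoundedSobolevNormsOn (Icc 0 T'') u)
    {C t₀ : ℝ} (ht₀ : 0 ≤ t₀) (ht₀T : t₀ < T)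
    (hω : ∀ t ∈ Ico t₀ T, ∀ x, (T - t) * ‖curl (u t) x‖ ≤ C) {q : ℝ} (hq : 1 < q)
    {κ : ℕ → ℝ} (hκ : ∀ n, 0 ≤ κ n)
    (hdep : ∀ n : ℕ, ∀ t ∈ Icc (T - (T - t₀) / q ^ n) (T - (T - t₀) / q ^ (n + 1)), ∀ Ω : ℝ,
      (∀ x, ‖curl (u t) x‖ ≤ Ω) →
      2 * ∫ x, ⟪curl (u t) x, fderiv ℝ (u t) x (curl (u t) x)⟫ ≤ κ n * Ω * ∫ x, ‖curl (u t) x‖ ^ 2)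
    (N : ℕ) :
    ∫ x, ‖curl (u (T - (T - t₀) / q ^ N)) x‖ ^ 2 ≤
      (∫ x, ‖curl (u t₀) x‖ ^ 2) * Real.exp (C * (q - 1) * ∑ n ∈ Finset.range N, κ n) := by
  set a : ℝ := T - t₀ with ha
  have ha0 : 0 < a := sub_pos.2 ht₀T
  have hq0 : 0 < q := by linarith
  induction N with
  | zero => simp [ha]
  | succ n ih =>
    have hqn : 0 < q ^ n := pow_pos hq0 n
    have hqn1 : 0 < q ^ (n + 1) := pow_pos hq0 (n + 1)
    have hlt : a / q ^ (n + 1) < a / q ^ n := by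
      rw [div_lt_div_iff_of_pos_left ha0 hqn1 hqn, pow_succ]
      exact lt_mul_of_one_lt_right hqn hq
    have hle : a / q ^ n ≤ a := div_le_self ha0.le (one_le_pow₀ hq.le)
    have hpos : 0 < a / q ^ (n + 1) := div_pos ha0 hqn1
    have ht₁ : 0 ≤ T - a / q ^ n := by linarith
    have h12 : T - a / q ^ n < T - a / q ^ (n + 1) := by linarith
    have ht₂ : T - a / q ^ (n + 1) < T := by linarith
    have hd : 0 < T - (T - a / q ^ (n + 1)) := by linarith
    have hωslab : ∀ t ∈ Icc (T - a / q ^ n) (T - a / q ^ (n + 1)), ∀ x,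
        ‖curl (u t) x‖ ≤ C / (T - (T - a / q ^ (n + 1))) := by
      intro t ht x
      have h := hω t ⟨by linarith [ht.1], by linarith [ht.2]⟩ x
      rw [le_div_iff₀ hd]
      calc ‖curl (u t) x‖ * (T - (T - a / q ^ (n + 1))) ≤ ‖curl (u t) x‖ * (T - t) :=
            mul_le_mul_of_nonneg_left (by linarith [ht.2]) (norm_nonneg _)
        _ = (T - t) * ‖curl (u t) x‖ := mul_comm _ _
        _ ≤ C := h
    have hΩ0 : 0 ≤ C / (T - (T - a / q ^ (n + 1))) := (norm_nonneg _).trans (hωslab _ ⟨le_rfl, h12.le⟩ 0)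
    have hstep := slab_gronwall_of_stretching_le hν hcl hreg ht₁ h12 ht₂ (mul_nonneg (hκ n) hΩ0)
      fun t ht => hdep n t ht _ (hωslab t ht)
    have hexp : κ n * (C / (T - (T - a / q ^ (n + 1)))) * (T - a / q ^ (n + 1) - (T - a / q ^ n)) =
        C * (q - 1) * κ n := by
      rw [sub_sub_cancel]
      field_simp
      ring
    rw [hexp] at hstep
    rw [Finset.sum_range_succ, mul_add, Real.exp_add]
    calc ∫ x, ‖curl (u (T - a / q ^ (n + 1))) x‖ ^ 2
        ≤ (∫ x, ‖curl (u (T - a / q ^ n)) x‖ ^ 2) * Real.exp (C * (q - 1) * κ n) := hstep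
      _ ≤ (∫ x, ‖curl (u t₀) x‖ ^ 2) * Real.exp (C * (q - 1) * ∑ i ∈ Finset.range n, κ i) *
            Real.exp (C * (q - 1) * κ n) := mul_le_mul_of_nonneg_right ih (Real.exp_nonneg _)
      _ = (∫ x, ‖curl (u t₀) x‖ ^ 2) * (Real.exp (C * (q - 1) * ∑ i ∈ Finset.range n, κ i) *
            Real.exp (C * (q - 1) * κ n)) := by ring

/-- **THE SLAB-MEAN FORM.** For a maximal Leray–Hopf classical solution of finite lifespan `T > 0` from a rapidly
decaying axisymmetric datum, `ν > 0`, with `(T − t)‖curl u(t, x)‖ ≤ C` on `[t₀, T) × ℝ³`, there is `K` — explicitly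
`K = log(∫|ω(t₀)|²·√(T − t₀)/(cν^{3/2}))`, `c` Leray's constant of `leray_le_integral_sq_norm_curl` — such that for EVERY
`q > 1`, EVERY family of per-slab coefficients `κₙ ≥ 0` with `(D_{κₙ})` on `[tₙ, tₙ₊₁]`, `tₙ = T − (T − t₀)q⁻ⁿ`, and every
`N`: **`(N/2)·log q − K ≤ C(q − 1)·Σ_{n<N} κₙ`** (Leray `cν^{3/2}√qᴺ/√(T − t₀) ≤ ∫|ω(t_N)|²` against the geometric
Grönwall). Hence `liminf_N (1/N)Σ_{n<N} κₙ ≥ log q/(2C(q − 1))`: the certificate constant times the slab-mean coefficient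
is at least `½·log q/(q − 1) → ½` (`q → 1⁺`). [cite: Leray1934, §20 (3.12); RobinsonRodrigoSadowski2016, Thm 12.3] -/
theorem exists_log_le_sum_depletion (hν : 0 < ν) (hT : 0 < T) (hmax : IsMaximalSmoothSolution ν 0 u p T)
    (hLH : IsLerayHopfOn T ν 0 (u 0) u) (hdec : HasRapidSpatialDecay (u 0)) (haxi : IsAxisymmetric (u 0))
    {C t₀ : ℝ} (ht₀ : 0 ≤ t₀) (ht₀T : t₀ < T) (hω : ∀ t ∈ Ico t₀ T, ∀ x, (T - t) * ‖curl (u t) x‖ ≤ C) :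
    ∃ K : ℝ, ∀ ⦃q : ℝ⦄, 1 < q → ∀ ⦃κ : ℕ → ℝ⦄, (∀ n, 0 ≤ κ n) →
      (∀ n : ℕ, ∀ t ∈ Icc (T - (T - t₀) / q ^ n) (T - (T - t₀) / q ^ (n + 1)), ∀ Ω : ℝ,
        (∀ x, ‖curl (u t) x‖ ≤ Ω) →
        2 * ∫ x, ⟪curl (u t) x, fderiv ℝ (u t) x (curl (u t) x)⟫ ≤ κ n * Ω * ∫ x, ‖curl (u t) x‖ ^ 2) →
      ∀ N : ℕ, (N : ℝ) * Real.log q / 2 - K ≤ C * (q - 1) * ∑ n ∈ Finset.range N, κ n := by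
  obtain ⟨c, hc, hler⟩ := leray_le_integral_sq_norm_curl
  have hreg := hasBoundedSobolevNormsOn_before_of_lerayHopf_classical hν hT hmax.1 hLH hdec
  set a : ℝ := T - t₀ with ha
  have ha0 : 0 < a := sub_pos.2 ht₀T
  set E₀ : ℝ := ∫ x, ‖curl (u t₀) x‖ ^ 2 with hE₀
  set L : ℝ := c * ν ^ (3 / 2 : ℝ) / Real.sqrt a with hL
  have hL0 : 0 < L := div_pos (mul_pos hc (Real.rpow_pos_of_pos hν _)) (Real.sqrt_pos.2 ha0)
  have hLE : L ≤ E₀ := hler hν hT hmax hLH hdec haxi t₀ ⟨ht₀, ht₀T⟩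
  have hE₀0 : 0 < E₀ := hL0.trans_le hLE
  refine ⟨Real.log E₀ - Real.log L, fun q hq κ hκ hdep N => ?_⟩
  have hq0 : 0 < q := by linarith
  have hqN : 0 < q ^ N := pow_pos hq0 N
  have hsq0 : 0 < Real.sqrt q := Real.sqrt_pos.2 hq0
  -- Leray at `t_N` against the geometric Grönwall
  have htN : T - a / q ^ N ∈ Ico 0 T := by
    refine ⟨?_, by linarith [div_pos ha0 hqN]⟩
    have : a / q ^ N ≤ a := div_le_self ha0.le (one_le_pow₀ hq.le)
    linarith
  have h1 := hler hν hT hmax hLH hdec haxi _ htN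
  have h2 := integral_sq_norm_curl_geometric_of_depletion hν hmax.1 hreg ht₀ ht₀T hω hq hκ hdep N
  have hsq : Real.sqrt (T - (T - a / q ^ N)) = Real.sqrt a / Real.sqrt q ^ N := by
    rw [sub_sub_cancel, Real.sqrt_div' a (le_of_lt hqN)]
    congr 1
    rw [show q ^ N = (Real.sqrt q ^ N) ^ 2 by rw [← pow_mul, mul_comm, pow_mul, Real.sq_sqrt hq0.le],
      Real.sqrt_sq (pow_nonneg (Real.sqrt_nonneg _) _)]
  have hLq : c * ν ^ (3 / 2 : ℝ) / Real.sqrt (T - (T - a / q ^ N)) = L * Real.sqrt q ^ N := by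
    rw [hsq, hL]
    field_simp
  rw [hLq] at h1
  have hchain : L * Real.sqrt q ^ N ≤ E₀ * Real.exp (C * (q - 1) * ∑ n ∈ Finset.range N, κ n) := h1.trans h2
  -- logarithms
  have hlog := Real.log_le_log (mul_pos hL0 (pow_pos hsq0 N)) hchain
  rw [Real.log_mul hL0.ne' (pow_pos hsq0 N).ne', Real.log_pow, Real.log_sqrt hq0.le,
    Real.log_mul hE₀0.ne' (Real.exp_pos _).ne', Real.log_exp] at hlog
  have hN : (N : ℝ) * (Real.log q / 2) = (N : ℝ) * Real.log q / 2 := by ring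
  linarith

end Summit.NavierStokesRegularity.NavierStokesRegularity.Theorems.CertifiedBlowupVorticityRateBlowup.DepletionFloor

end
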